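import Summits.QuantumFields.YangMills.Theorems.FluctuationComparisonRegPrIntLS1aCellMapChartRead
import HarnessLib

/-!
# `FluctuationComparisonRegPrIntLS1aCellMapChartReadDiagonal` — FILE B OF THE CHART-READ CELL MAP: THE DIAGONAL BLOCKS OF `Dψ(0)` ARE INJECTIVE
# (lit ✓`T4EMLTangentInjective.emlD_tangent_injective`, ZERO SMALLNESS; the axial branch `c ∉ s` is `Ad_{pre}`)

Cell `ym3-torus` (HUMAN RULING D-0037: rung R3 = continuum SU(2) Yang–Mills on T³ — NOT d = 4, NOT infinite volume, NOT a mass gap, NOT Clay), WIDTH COPY «width 17»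
of ym3-torus-p1, seat `ym3-torus-px17` gen 21; `--kind proof --supports stmt-QuantumFields-20520 --as helper` (count-neutral).  THEOREMS ONLY (no `def`, no `sorry`,
no `instance`, no `notation`, default heartbeats).  FILE (F5a) of the seat's 12:58Z INTENT (S1aᴴ `RunClassMembershipH` conjunct (c) at the ANCHOR heights, local-face road
on the FULL guard): the calculus half of the face; (F5b) feeds it to ✓p823765 `…S1aSubmersionDensityFibreAE` (prescribed fibre coordinate = the non-private bonds).

WHY ∕ HOW (§2b).  Along the one-bond ray `t ↦ t·X δ_{β(c)}` the `c`-component of the chart-read cell map `ψ(A) = Λ(cell(Θ^B(A)·U₀)(c)·cell(U₀)(c)⁻¹)` is, near `t = 0`,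
`log(K(W_t)·K(W₀)⋆)` with `W_t = pre·e^{tX}·U₀(β(c))·post` and `K = Kmat (offHol U₀ c) (|I|⁻¹)` on the `1∕2`-window (file A + ✓`coe_cellMap_update_centralBond_self_eq_kmat`),
resp. `log(W_t·W₀⋆)` for `c ∉ s`.  If the derivative of the `c`-component at `0` kills `X δ_{β(c)}`, the model derivative `emlD(W₀)[(pre·X·pre⋆)·W₀]·K(W₀)⋆` vanishes
(lit ✓`hasStrictFDerivAt_Kmat`, `D log(1) = id`), whence `pre·X·pre⋆ = 0` by lit ✓`emlD_tangent_injective` (unitary family in the guard `< 1∕2`, weights `|I|⁻¹ ≥ 0` of total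
`< 1`, ✓`sum_emlWeight_lt_one`) and `X = 0`; for `c ∉ s` directly.  Pure matrix calculus + the two eventual identities along the ray.

CONTENT (namespace `Summit.QuantumFields.YangMills.Theorems.FluctuationComparisonRegPrIntLS1aCellMapChartRead`, continued).  `hasDerivAt_mlog_kmat_ray`, `eventually_norm_kmat_ray_sub_one_lt`, `hasDerivAt_mlog_axial_ray`,
`eq_zero_of_mul_mul_eq_zero`, `conjTranspose_conj_eq_neg`, `emlD_apply_eq_zero_of_mul_eq_zero`, `eq_zero_of_emlD_conj_mul_eq_zero`, ★`coe_chartRead_ray_self_eventuallyEq_of_mem`,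
★`coe_chartRead_ray_self_eventuallyEq_of_not_mem`, ★★★`eq_zero_of_fderiv_chartRead_single_apply_self`.

HONEST FRAMING.  Chart calculus over pub-ymgap's N09∕N07 files, lit `T4EMLTangentInjective`, `Node00.AveragingSmooth`, `HaarExponentialChart*`; nothing of Bałaban's analysis is
asserted or proved; S1aᴴ (c) at the anchor heights NOT closed by this file ((F4-b) px20 g22, (F5b), (F6) remain); (m), (a), S1aᴴ, the five registered stubs, crux 20520 ∕
19936 ∕ 19200 and `YM3TorusSU2` NOT proved; rung R3 = SU(2) YM₃ on T³ — NOT d = 4, NOT infinite volume, NOT a mass gap, NOT Clay; the Yang–Mills mass gap is NOT proved.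
References: [Balaban1987RG1] CMP 109 (1987) (0.4) p. 253; [Helgason2000] Ch. I §1 Thm. 1.14; [EvansGariepy1992] §3.4.
-/

set_option autoImplicit false

noncomputable section

open scoped Matrix.Norms.L2Operator Topology ENNReal Matrix
open Filter Set Function MeasureTheory

namespace Summit.QuantumFields.YangMills.Theorems.FluctuationComparisonRegPrIntLS1aCellMapChartRead

open Literature.MathematicalPhysics.QuantumFieldTheory.Balaban1983to89
open Literature.MathematicalPhysics.QuantumFieldTheory.Balaban1983to89.HaarExponentialChart
open Literature.MathematicalPhysics.QuantumFieldTheory.Balaban1983to89.HaarExponentialChart.IsChartRep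
open Literature.MathematicalPhysics.QuantumFieldTheory.Balaban1983to89.BlockAveraging (Small Idx avgFun loopHol)
open Literature.MathematicalPhysics.QuantumFieldTheory.Balaban1983to89.BlockAveragingHaarAC (centralBond IsCentral openHol pre post centralBond_injective
  loopHol_update_centralBond axialAvg_update_centralBond_of_ne axialAvg_update_centralBond)
open Literature.MathematicalPhysics.QuantumFieldTheory.Balaban1983to89.BlockAveragingEMLHaarAC (fibreFamily offHol offCard emlWeight emlWeight_nonneg sum_emlWeight_lt_one
  loopHol_update_centralBond_self coe_fibreFamily_of_not_isCentral fibreFamily_of_isCentral)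
open Literature.MathematicalPhysics.QuantumFieldTheory.Balaban1983to89.ExpMeanLog (expMeanLogSU deltaSU eml)
open Literature.MathematicalPhysics.QuantumFieldTheory.Balaban1983to89.Node00 (SU coeField avgM axialM corrM loopM contDiffAt_corrM contDiff_axialM contDiff_loopM
  coe_loopHol coe_axialAvg coe_mul_star_coe_SU star_coe_mul_coe_SU coe_inv_SU)
open Literature.MathematicalPhysics.QuantumLattice (fundamentalRep fundamentalRep_apply)
open MatrixLog (mlog analyticAt_mlog mlog_one)
open T4EMLTangentInjective (Kmat emlD hasStrictFDerivAt_Kmat emlD_tangent_injective)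
open Summit.QuantumFields.YangMills.BalabanUVNodes.N09ChartReadAveragingSmooth (contDiffAt_of_coe coe_fderiv_apply_eq hasDerivAt_along_ray coe_expChart
  coeField_piExpChart_translate piExpChart_translate_zero contDiff_coeField_piExpChart_translate piExpChart_translate_smul_single)
open Summit.QuantumFields.YangMills.Theorems.FluctuationComparisonRegPrIntLS1aCellMapExtendedAverage

variable {P : Params} {j : ℕ}
variable (E : (Idx P → SU 2) → SU 2) (s : Finset (PBond P (j + 1))) (U₀ : GaugeField P j (SU 2))

/-! ## §2b The diagonal blocks of `Dψ(0)`: INJECTIVE by `emlD_tangent_injective` -/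

section Blocks

/-- THE `Kmat` MODEL RAY (generic matrix calculus): for matrices `p, g, q, X, sK` and a family `hh` in the guard `‖hh_k·(pgq)* − 1‖ < 1` with `Kmat(pgq)·sK = 1`,
`t ↦ log(Kmat hh w (p·e^{tX}·g·q)·sK)` has derivative `emlD hh w (pgq) [p·X·g·q]·sK` at `0` (lit ✓`hasStrictFDerivAt_Kmat`, `D log(1) = id`). [folklore] -/
theorem hasDerivAt_mlog_kmat_ray {ι : Type*} [Fintype ι] (hh : ι → Matrix (Fin 2) (Fin 2) ℂ) (w : ι → ℝ) (p g q Xm sK : Matrix (Fin 2) (Fin 2) ℂ)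
    (hg : ∀ k, ‖hh k * star (p * g * q) - 1‖ < 1) (hone : Kmat hh w (p * g * q) * sK = 1) :
    HasDerivAt (fun t : ℝ => mlog (Kmat hh w (p * (NormedSpace.exp (t • Xm) * g) * q) * sK)) (emlD hh w (p * g * q) (p * (Xm * g) * q) * sK) 0 := by
  letI : NormedAlgebra ℚ (Matrix (Fin 2) (Fin 2) ℂ) := NormedAlgebra.restrictScalars ℚ ℂ _
  have hW : HasDerivAt (fun t : ℝ => p * (NormedSpace.exp (t • Xm) * g) * q) (p * (Xm * g) * q) 0 := by
    have hexp := (hasDerivAt_exp_smul_const (𝕂 := ℝ) Xm (0 : ℝ)).mul_const g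
    rw [zero_smul, NormedSpace.exp_zero, one_mul] at hexp
    exact (hexp.const_mul p).mul_const q
  have hW0 : p * (NormedSpace.exp ((0 : ℝ) • Xm) * g) * q = p * g * q := by rw [zero_smul, NormedSpace.exp_zero, one_mul]
  have hK : HasStrictFDerivAt (Kmat hh w) (emlD hh w (p * g * q)) (p * g * q) := hasStrictFDerivAt_Kmat hh w hg
  have h1 : HasDerivAt (fun t : ℝ => Kmat hh w (p * (NormedSpace.exp (t • Xm) * g) * q)) (emlD hh w (p * g * q) (p * (Xm * g) * q)) 0 :=
    hK.hasFDerivAt.comp_hasDerivAt_of_eq (0 : ℝ) hW hW0.symm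
  have h2 := h1.mul_const sK
  have hval : Kmat hh w (p * (NormedSpace.exp ((0 : ℝ) • Xm) * g) * q) * sK = 1 := by rw [hW0]; exact hone
  have hlog : HasFDerivAt (mlog : Matrix (Fin 2) (Fin 2) ℂ → Matrix (Fin 2) (Fin 2) ℂ)
      ((1 : Matrix (Fin 2) (Fin 2) ℂ →L[ℂ] Matrix (Fin 2) (Fin 2) ℂ).restrictScalars ℝ) 1 :=
    (B7TransferAnalyticMean.hasFDerivAt_mlog_one (𝔄 := Matrix (Fin 2) (Fin 2) ℂ)).restrictScalars ℝ
  have h3 := hlog.comp_hasDerivAt_of_eq (0 : ℝ) h2 hval.symm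
  exact h3.congr_deriv rfl

/-- THE `Kmat` MODEL ALONG A MATRIX RAY IS EVENTUALLY `r`-CLOSE TO ITS BASE VALUE (pure matrix bookkeeping: continuity at `t = 0` of
`t ↦ Kmat h w (p·exp(tX)·g·q)·sK`, normalised by `Kmat h w (p g q)·sK = 1`). [cite: Balaban1985RegularSpaces, (1.10) p.77 (bookkeeping)] -/
theorem eventually_norm_kmat_ray_sub_one_lt {ι : Type*} [Fintype ι] (hh : ι → Matrix (Fin 2) (Fin 2) ℂ) (w : ι → ℝ) (p g q Xm sK : Matrix (Fin 2) (Fin 2) ℂ)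
    (hg : ∀ k, ‖hh k * star (p * g * q) - 1‖ < 1) (hone : Kmat hh w (p * g * q) * sK = 1) {r : ℝ} (hr : 0 < r) :
    ∀ᶠ t : ℝ in 𝓝 0, ‖Kmat hh w (p * (NormedSpace.exp (t • Xm) * g) * q) * sK - 1‖ < r := by
  letI : NormedAlgebra ℚ (Matrix (Fin 2) (Fin 2) ℂ) := NormedAlgebra.restrictScalars ℚ ℂ _
  have hW : HasDerivAt (fun t : ℝ => p * (NormedSpace.exp (t • Xm) * g) * q) (p * (Xm * g) * q) 0 := by
    have hexp := (hasDerivAt_exp_smul_const (𝕂 := ℝ) Xm (0 : ℝ)).mul_const g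
    rw [zero_smul, NormedSpace.exp_zero, one_mul] at hexp
    exact (hexp.const_mul p).mul_const q
  have hW0 : p * (NormedSpace.exp ((0 : ℝ) • Xm) * g) * q = p * g * q := by rw [zero_smul, NormedSpace.exp_zero, one_mul]
  have hK : HasStrictFDerivAt (Kmat hh w) (emlD hh w (p * g * q)) (p * g * q) := hasStrictFDerivAt_Kmat hh w hg
  have h1 : HasDerivAt (fun t : ℝ => Kmat hh w (p * (NormedSpace.exp (t • Xm) * g) * q)) (emlD hh w (p * g * q) (p * (Xm * g) * q)) 0 :=
    hK.hasFDerivAt.comp_hasDerivAt_of_eq (0 : ℝ) hW hW0.symm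
  have h2 := (h1.mul_const sK).continuousAt
  have h3 : ContinuousAt (fun t : ℝ => ‖Kmat hh w (p * (NormedSpace.exp (t • Xm) * g) * q) * sK - 1‖) 0 := (h2.sub continuousAt_const).norm
  refine h3.eventually (isOpen_Iio.mem_nhds ?_)
  show ‖Kmat hh w (p * (NormedSpace.exp ((0 : ℝ) • Xm) * g) * q) * sK - 1‖ < r
  rw [hW0, hone, sub_self, norm_zero]; exact hr

/-- THE AXIAL MODEL RAY: `t ↦ log(p·e^{tX}·g·q·(pgq)⋆)` has derivative `p·X·g·q·(pgq)⋆` at `0` when `(pgq)(pgq)⋆ = 1`. [folklore] -/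
theorem hasDerivAt_mlog_axial_ray (p g q Xm : Matrix (Fin 2) (Fin 2) ℂ) (hone : (p * g * q) * star (p * g * q) = 1) :
    HasDerivAt (fun t : ℝ => mlog (p * (NormedSpace.exp (t • Xm) * g) * q * star (p * g * q))) (p * (Xm * g) * q * star (p * g * q)) 0 := by
  letI : NormedAlgebra ℚ (Matrix (Fin 2) (Fin 2) ℂ) := NormedAlgebra.restrictScalars ℚ ℂ _
  have hW : HasDerivAt (fun t : ℝ => p * (NormedSpace.exp (t • Xm) * g) * q) (p * (Xm * g) * q) 0 := by
    have hexp := (hasDerivAt_exp_smul_const (𝕂 := ℝ) Xm (0 : ℝ)).mul_const g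
    rw [zero_smul, NormedSpace.exp_zero, one_mul] at hexp
    exact (hexp.const_mul p).mul_const q
  have h2 := hW.mul_const (star (p * g * q))
  have hval : p * (NormedSpace.exp ((0 : ℝ) • Xm) * g) * q * star (p * g * q) = 1 := by
    rw [zero_smul, NormedSpace.exp_zero, one_mul]; exact hone
  have hlog : HasFDerivAt (mlog : Matrix (Fin 2) (Fin 2) ℂ → Matrix (Fin 2) (Fin 2) ℂ)
      ((1 : Matrix (Fin 2) (Fin 2) ℂ →L[ℂ] Matrix (Fin 2) (Fin 2) ℂ).restrictScalars ℝ) 1 :=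
    (B7TransferAnalyticMean.hasFDerivAt_mlog_one (𝔄 := Matrix (Fin 2) (Fin 2) ℂ)).restrictScalars ℝ
  have h3 := hlog.comp_hasDerivAt_of_eq (0 : ℝ) h2 hval.symm
  exact h3.congr_deriv rfl

/-- Cancelling a two-sided product: `a′a = 1`, `bb′ = 1`, `aMb = 0 ⟹ M = 0`. [folklore] -/
theorem eq_zero_of_mul_mul_eq_zero {m : Type*} [Fintype m] [DecidableEq m] {a a' b b' M : Matrix m m ℂ} (ha : a' * a = 1) (hb : b * b' = 1)
    (h : a * M * b = 0) : M = 0 := by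
  calc M = (a' * a) * M * (b * b') := by rw [ha, hb, one_mul, mul_one]
    _ = a' * (a * M * b) * b' := by simp only [mul_assoc]
    _ = 0 := by rw [h, mul_zero, zero_mul]

/-- Skew-Hermitian matrices are stable under `Y ↦ W⋆(uYu⋆)W`. [folklore] -/
theorem conjTranspose_conj_eq_neg {m : Type*} [Fintype m] (W₀ u Xm : Matrix m m ℂ) (hX : star Xm = -Xm) :
    (star W₀ * (u * Xm * star u) * W₀)ᴴ = -(star W₀ * (u * Xm * star u) * W₀) := by
  rw [← Matrix.star_eq_conjTranspose]
  simp only [star_mul, star_star, hX, mul_neg, neg_mul, mul_assoc]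

/-- Transport of the kernel equation: `emlD(W₀)[(uXu⋆)W₀]·sK = 0`, `sK·K = 1`, `W₀W₀⋆ = 1` ⟹ `emlD(W₀)[W₀·(W₀⋆(uXu⋆)W₀)] = 0`. [folklore] -/
theorem emlD_apply_eq_zero_of_mul_eq_zero {m : Type*} [Fintype m] [DecidableEq m] [Nonempty m] {ι : Type*} [Fintype ι]
    (hh : ι → Matrix m m ℂ) (w : ι → ℝ) {W₀ u Xm sK K : Matrix m m ℂ} (hW₀u : W₀ * star W₀ = 1) (hsK : sK * K = 1)
    (hD : emlD hh w W₀ ((u * Xm * star u) * W₀) * sK = 0) : emlD hh w W₀ (W₀ * (star W₀ * (u * Xm * star u) * W₀)) = 0 := by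
  have hY : W₀ * (star W₀ * (u * Xm * star u) * W₀) = (u * Xm * star u) * W₀ := by
    rw [show W₀ * (star W₀ * (u * Xm * star u) * W₀) = (W₀ * star W₀) * (u * Xm * star u) * W₀ by simp only [mul_assoc], hW₀u, one_mul]
  rw [hY]
  calc emlD hh w W₀ ((u * Xm * star u) * W₀) = emlD hh w W₀ ((u * Xm * star u) * W₀) * (sK * K) := by rw [hsK, mul_one]
    _ = (emlD hh w W₀ ((u * Xm * star u) * W₀) * sK) * K := (mul_assoc _ _ _).symm
    _ = 0 := by rw [hD, zero_mul]

/-- ALGEBRA OF THE TANGENT DIRECTION: if `emlD hh w W₀ [(uXu⋆)·W₀]·sK = 0` with `sK·K = 1`, `u, W₀` unitary, `hh_k` unitary in the guard `< 1∕2`, weights `≥ 0` of total `< 1`,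
and `X` skew-Hermitian, then `X = 0` — lit ✓`emlD_tangent_injective` applied to the tangent vector `W₀·(W₀⋆(uXu⋆)W₀)`. [folklore] -/
theorem eq_zero_of_emlD_conj_mul_eq_zero {m : Type*} [Fintype m] [DecidableEq m] [Nonempty m] {ι : Type*} [Fintype ι] {hh : ι → Matrix m m ℂ}
    (hhu : ∀ k, hh k ∈ Matrix.unitaryGroup m ℂ)
    {w : ι → ℝ} (hw0 : ∀ k, 0 ≤ w k) (hw1 : ∑ k, w k < 1) {W₀ u Xm sK K : Matrix m m ℂ} (hW₀ : W₀ ∈ Matrix.unitaryGroup m ℂ)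
    (hW₀u : W₀ * star W₀ = 1) (hu' : star u * u = 1) (hg : ∀ k, ‖hh k * star W₀ - 1‖ < 1 / 2) (hX : star Xm = -Xm) (hsK : sK * K = 1)
    (hD : emlD hh w W₀ ((u * Xm * star u) * W₀) * sK = 0) : Xm = 0 := by
  have hinj : star W₀ * (u * Xm * star u) * W₀ = 0 :=
    emlD_tangent_injective hhu hW₀ hg hw0 hw1 (star W₀ * (u * Xm * star u) * W₀) (conjTranspose_conj_eq_neg W₀ u Xm hX)
      (emlD_apply_eq_zero_of_mul_eq_zero hh w hW₀u hsK hD)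
  have h1 : u * Xm * star u = 0 := eq_zero_of_mul_mul_eq_zero (a := star W₀) (a' := W₀) (b := W₀) (b' := star W₀) hW₀u hW₀u hinj
  exact eq_zero_of_mul_mul_eq_zero (a := u) (a' := star u) (b := star u) (b' := u) hu' hu' h1

/-- THE DIAGONAL RAY IS EVENTUALLY THE `Kmat` MODEL (`c ∈ s`): near `t = 0` the matrix of the `c`-component along `t ↦ t·X δ_{β(c)}` is
`log(Kmat hh w (↑pre·e^{t↑X}·↑g₀·↑post)·(Kmat hh w ↑U₀(c))⋆)`, `hh = ↑offHol U₀ c`, `w ≡ |I|⁻¹` (✓`coe_cellMap_update_centralBond_self_eq_kmat` while the fibre families stay in the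
`1∕2`-guard and the relative point stays in the chart's inner radius). [cite: Balaban1987RG1, (0.4) p.253 (bookkeeping)] -/
theorem coe_chartRead_ray_self_eventuallyEq_of_mem (hj : j + 1 ≤ P.m + P.K)
    (hEeml : ∀ W, (∀ i, ‖((W i : SU 2) : Matrix (Fin 2) (Fin 2) ℂ) - 1‖ < 1 / 2) →
      ((E W : SU 2) : Matrix (Fin 2) (Fin 2) ℂ) = eml fun i => ((W i : SU 2) : Matrix (Fin 2) (Fin 2) ℂ))
    (hwin : ∀ c ∈ s, ∀ i, ‖((loopHol U₀ c i : SU 2) : Matrix (Fin 2) (Fin 2) ℂ) - 1‖ < 1 / 2)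
    {c : PBond P (j + 1)} (hc : c ∈ s) (X : (specialUnitaryLogChart (Fin 2)).lie) :
    (fun t : ℝ => (((isChartRep_specialUnitaryGroup (n := Fin 2)).logChart
        ((if c ∈ s then E (loopHol (fun b => (isChartRep_specialUnitaryGroup (n := Fin 2)).expChart
            ((t • (Pi.single (centralBond c) X : PBond P j → (specialUnitaryLogChart (Fin 2)).lie)) b) * U₀ b) c) else 1) *
            AveragingRT.axialAvg (fun b => (isChartRep_specialUnitaryGroup (n := Fin 2)).expChart
              ((t • (Pi.single (centralBond c) X : PBond P j → (specialUnitaryLogChart (Fin 2)).lie)) b) * U₀ b) c *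
          ((if c ∈ s then E (loopHol U₀ c) else 1) * AveragingRT.axialAvg U₀ c)⁻¹) : (specialUnitaryLogChart (Fin 2)).lie) : Matrix (Fin 2) (Fin 2) ℂ)) =ᶠ[𝓝 0]
    fun t : ℝ => mlog (Kmat (fun k : Fin (offCard c) => ((offHol U₀ c k : SU 2) : Matrix (Fin 2) (Fin 2) ℂ)) (fun _ => emlWeight P)
        (((pre U₀ c : SU 2) : Matrix (Fin 2) (Fin 2) ℂ) * (NormedSpace.exp (t • ((X : (specialUnitaryLogChart (Fin 2)).lie) : Matrix (Fin 2) (Fin 2) ℂ)) *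
          ((U₀ (centralBond c) : SU 2) : Matrix (Fin 2) (Fin 2) ℂ)) * ((post U₀ c : SU 2) : Matrix (Fin 2) (Fin 2) ℂ)) *
        star (Kmat (fun k : Fin (offCard c) => ((offHol U₀ c k : SU 2) : Matrix (Fin 2) (Fin 2) ℂ)) (fun _ => emlWeight P)
          ((AveragingRT.axialAvg U₀ c : SU 2) : Matrix (Fin 2) (Fin 2) ℂ))) := by
  set hR := isChartRep_specialUnitaryGroup (n := Fin 2) with hhR
  set hh : Fin (offCard c) → Matrix (Fin 2) (Fin 2) ℂ := fun k => ((offHol U₀ c k : SU 2) : Matrix (Fin 2) (Fin 2) ℂ) with hhh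
  set w : Fin (offCard c) → ℝ := fun _ => emlWeight P with hw
  -- the private ray in `SU(2)` and its matrix
  set W : ℝ → SU 2 := fun t => pre U₀ c * (hR.expChart (t • X) * U₀ (centralBond c)) * post U₀ c with hW
  have hcoeW : ∀ t, ((W t : SU 2) : Matrix (Fin 2) (Fin 2) ℂ) = ((pre U₀ c : SU 2) : Matrix (Fin 2) (Fin 2) ℂ) *
      (NormedSpace.exp (t • ((X : (specialUnitaryLogChart (Fin 2)).lie) : Matrix (Fin 2) (Fin 2) ℂ)) * ((U₀ (centralBond c) : SU 2) : Matrix (Fin 2) (Fin 2) ℂ)) *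
        ((post U₀ c : SU 2) : Matrix (Fin 2) (Fin 2) ℂ) := by
    intro t
    simp only [hW, Submonoid.coe_mul, Summit.QuantumFields.YangMills.BalabanUVNodes.N09ChartReadAveragingSmooth.coe_expChart, Submodule.coe_smul]
  have hW0 : W 0 = AveragingRT.axialAvg U₀ c := by
    simp only [hW, zero_smul, hR.expChart_zero, one_mul]; exact (fibre_basePoint (P := P) (j := j) U₀ c).1
  have hcontW : Continuous fun t : ℝ => W t := by
    simp only [hW]
    exact (continuous_const.mul ((hR.continuous_expChart.comp (continuous_id.smul continuous_const)).mul continuous_const)).mul continuous_const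
  -- the fibre map `F` and its value at the base point
  have hfb : fibreFamily U₀ c (AveragingRT.axialAvg U₀ c) = loopHol U₀ c := (fibre_basePoint (P := P) (j := j) U₀ c).2
  -- the fibre families along the ray stay in the `1∕2`-guard near `0`
  have hguard0 : ∀ i, ‖((fibreFamily U₀ c (W 0) i : SU 2) : Matrix (Fin 2) (Fin 2) ℂ) - 1‖ < 1 / 2 := by
    intro i; rw [hW0, hfb]; exact hwin c hc i
  have hguardT : ∀ᶠ t in 𝓝 (0 : ℝ), ∀ i, ‖((fibreFamily U₀ c (W t) i : SU 2) : Matrix (Fin 2) (Fin 2) ℂ) - 1‖ < 1 / 2 := by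
    have hcF : Continuous fun W' : SU 2 => fibreFamily U₀ c W' := continuous_pi fun i => by
      by_cases hi : IsCentral c i
      · have hfun : (fun W' : SU 2 => fibreFamily U₀ c W' i) = fun _ => 1 := funext fun W' => fibreFamily_of_isCentral U₀ c W' i hi
        rw [hfun]; exact continuous_const
      · have hfun : (fun W' : SU 2 => fibreFamily U₀ c W' i) = fun W' => openHol U₀ c i * W'⁻¹ :=
          funext fun W' => BlockAveragingEMLHaarAC.fibreFamily_of_not_isCentral U₀ c W' i hi
        rw [hfun]; exact continuous_const.mul continuous_inv
    have hcf : Continuous fun t : ℝ => fibreFamily U₀ c (W t) := hcF.comp hcontW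
    exact hcf.continuousAt.eventually (isOpen_halfGuard.mem_nhds hguard0)
  -- the `Kmat` formula along the ray
  have hKmat : ∀ t, (∀ i, ‖((fibreFamily U₀ c (W t) i : SU 2) : Matrix (Fin 2) (Fin 2) ℂ) - 1‖ < 1 / 2) →
      (((if c ∈ s then E (fibreFamily U₀ c (W t)) else 1) * W t : SU 2) : Matrix (Fin 2) (Fin 2) ℂ) = Kmat hh w ((W t : SU 2) : Matrix (Fin 2) (Fin 2) ℂ) := by
    intro t ht
    rw [if_pos hc, Submonoid.coe_mul, coe_E_fibreFamily_eq_exp_sum E hEeml U₀ c ht, Kmat]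
  have hK0 : Kmat hh w ((AveragingRT.axialAvg U₀ c : SU 2) : Matrix (Fin 2) (Fin 2) ℂ) =
      ((((if c ∈ s then E (loopHol U₀ c) else 1) * AveragingRT.axialAvg U₀ c : SU 2)) : Matrix (Fin 2) (Fin 2) ℂ) := by
    have := hKmat 0 hguard0
    rw [hW0, hfb] at this
    exact this.symm
  set sK : Matrix (Fin 2) (Fin 2) ℂ := star (Kmat hh w ((AveragingRT.axialAvg U₀ c : SU 2) : Matrix (Fin 2) (Fin 2) ℂ)) with hsK
  have hone : Kmat hh w ((W 0 : SU 2) : Matrix (Fin 2) (Fin 2) ℂ) * sK = 1 := by rw [hW0, hsK, hK0]; exact coe_mul_star_coe_SU _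
  -- the inner-radius window, from the matrix-ray bookkeeping
  have hpgq : ((W 0 : SU 2) : Matrix (Fin 2) (Fin 2) ℂ) =
      ((pre U₀ c : SU 2) : Matrix (Fin 2) (Fin 2) ℂ) * ((U₀ (centralBond c) : SU 2) : Matrix (Fin 2) (Fin 2) ℂ) * ((post U₀ c : SU 2) : Matrix (Fin 2) (Fin 2) ℂ) := by
    rw [hW0, ← (fibre_basePoint (P := P) (j := j) U₀ c).1, Submonoid.coe_mul, Submonoid.coe_mul]
  have hgK : ∀ k, ‖hh k * star (((pre U₀ c : SU 2) : Matrix (Fin 2) (Fin 2) ℂ) * ((U₀ (centralBond c) : SU 2) : Matrix (Fin 2) (Fin 2) ℂ) *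
      ((post U₀ c : SU 2) : Matrix (Fin 2) (Fin 2) ℂ)) - 1‖ < 1 := by
    intro k
    have := hguard0 ((BlockAveragingEMLHaarAC.offEquiv c).symm k).1
    rw [coe_fibreFamily_of_not_isCentral U₀ c (W 0) _ ((BlockAveragingEMLHaarAC.offEquiv c).symm k).2, hpgq] at this
    exact this.trans (by norm_num)
  have hone' : Kmat hh w (((pre U₀ c : SU 2) : Matrix (Fin 2) (Fin 2) ℂ) * ((U₀ (centralBond c) : SU 2) : Matrix (Fin 2) (Fin 2) ℂ) *
      ((post U₀ c : SU 2) : Matrix (Fin 2) (Fin 2) ℂ)) * sK = 1 := by rw [← hpgq]; exact hone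
  have hnear : ∀ᶠ t in 𝓝 (0 : ℝ), ‖Kmat hh w ((W t : SU 2) : Matrix (Fin 2) (Fin 2) ℂ) * sK - 1‖ < innerRadius (specialUnitaryLogChart (Fin 2)) := by
    filter_upwards [eventually_norm_kmat_ray_sub_one_lt hh w _ _ _ ((X : (specialUnitaryLogChart (Fin 2)).lie) : Matrix (Fin 2) (Fin 2) ℂ) sK hgK hone'
      (innerRadius_pos (C := specialUnitaryLogChart (Fin 2)))] with t ht
    rwa [hcoeW t]
  filter_upwards [hguardT, hnear] with t ht hn
  have hcoe : ((((if c ∈ s then E (fibreFamily U₀ c (W t)) else 1) * W t * ((if c ∈ s then E (loopHol U₀ c) else 1) * AveragingRT.axialAvg U₀ c)⁻¹ : SU 2)) :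
      Matrix (Fin 2) (Fin 2) ℂ) = Kmat hh w ((W t : SU 2) : Matrix (Fin 2) (Fin 2) ℂ) * sK := by
    rw [Submonoid.coe_mul, coe_inv_SU, hKmat t ht, hsK, hK0]
  have hρ : ‖fundamentalRep (Fin 2) ((if c ∈ s then E (fibreFamily U₀ c (W t)) else 1) * W t *
      ((if c ∈ s then E (loopHol U₀ c) else 1) * AveragingRT.axialAvg U₀ c)⁻¹) - 1‖ < innerRadius (specialUnitaryLogChart (Fin 2)) := by
    rw [fundamentalRep_apply, hcoe]; exact hn
  rw [chartRead_ray_apply_self E s U₀ hj c X t]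
  show ((hR.logChart ((if c ∈ s then E (fibreFamily U₀ c (W t)) else 1) * W t * ((if c ∈ s then E (loopHol U₀ c) else 1) * AveragingRT.axialAvg U₀ c)⁻¹) :
      (specialUnitaryLogChart (Fin 2)).lie) : Matrix (Fin 2) (Fin 2) ℂ) = _
  rw [hR.coe_logChart hρ, fundamentalRep_apply, hcoe, hcoeW t]

/-- THE DIAGONAL RAY IS EVENTUALLY THE AXIAL MODEL (`c ∉ s`): near `t = 0` the matrix of the `c`-component along `t ↦ t·X δ_{β(c)}` is `log(↑pre·e^{t↑X}·↑g₀·↑post·(↑U₀(c))⋆)`.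
[cite: Balaban1987RG1, (0.4) p.253 (bookkeeping)] -/
theorem coe_chartRead_ray_self_eventuallyEq_of_not_mem (hj : j + 1 ≤ P.m + P.K) {c : PBond P (j + 1)} (hc : c ∉ s) (X : (specialUnitaryLogChart (Fin 2)).lie) :
    (fun t : ℝ => (((isChartRep_specialUnitaryGroup (n := Fin 2)).logChart
        ((if c ∈ s then E (loopHol (fun b => (isChartRep_specialUnitaryGroup (n := Fin 2)).expChart
            ((t • (Pi.single (centralBond c) X : PBond P j → (specialUnitaryLogChart (Fin 2)).lie)) b) * U₀ b) c) else 1) *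
            AveragingRT.axialAvg (fun b => (isChartRep_specialUnitaryGroup (n := Fin 2)).expChart
              ((t • (Pi.single (centralBond c) X : PBond P j → (specialUnitaryLogChart (Fin 2)).lie)) b) * U₀ b) c *
          ((if c ∈ s then E (loopHol U₀ c) else 1) * AveragingRT.axialAvg U₀ c)⁻¹) : (specialUnitaryLogChart (Fin 2)).lie) : Matrix (Fin 2) (Fin 2) ℂ)) =ᶠ[𝓝 0]
    fun t : ℝ => mlog (((pre U₀ c : SU 2) : Matrix (Fin 2) (Fin 2) ℂ) * (NormedSpace.exp (t • ((X : (specialUnitaryLogChart (Fin 2)).lie) : Matrix (Fin 2) (Fin 2) ℂ)) *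
          ((U₀ (centralBond c) : SU 2) : Matrix (Fin 2) (Fin 2) ℂ)) * ((post U₀ c : SU 2) : Matrix (Fin 2) (Fin 2) ℂ) *
        star ((AveragingRT.axialAvg U₀ c : SU 2) : Matrix (Fin 2) (Fin 2) ℂ)) := by
  set hR := isChartRep_specialUnitaryGroup (n := Fin 2) with hhR
  set W : ℝ → SU 2 := fun t => pre U₀ c * (hR.expChart (t • X) * U₀ (centralBond c)) * post U₀ c with hW
  have hcoeW : ∀ t, ((W t : SU 2) : Matrix (Fin 2) (Fin 2) ℂ) = ((pre U₀ c : SU 2) : Matrix (Fin 2) (Fin 2) ℂ) *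
      (NormedSpace.exp (t • ((X : (specialUnitaryLogChart (Fin 2)).lie) : Matrix (Fin 2) (Fin 2) ℂ)) * ((U₀ (centralBond c) : SU 2) : Matrix (Fin 2) (Fin 2) ℂ)) *
        ((post U₀ c : SU 2) : Matrix (Fin 2) (Fin 2) ℂ) := by
    intro t
    simp only [hW, Submonoid.coe_mul, Summit.QuantumFields.YangMills.BalabanUVNodes.N09ChartReadAveragingSmooth.coe_expChart, Submodule.coe_smul]
  have hW0 : W 0 = AveragingRT.axialAvg U₀ c := by
    simp only [hW, zero_smul, hR.expChart_zero, one_mul]; exact (fibre_basePoint (P := P) (j := j) U₀ c).1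
  have hcontW : Continuous fun t : ℝ => ((W t : SU 2) : Matrix (Fin 2) (Fin 2) ℂ) := by
    refine continuous_subtype_val.comp ?_
    simp only [hW]
    exact (continuous_const.mul ((hR.continuous_expChart.comp (continuous_id.smul continuous_const)).mul continuous_const)).mul continuous_const
  have hone : ((W 0 : SU 2) : Matrix (Fin 2) (Fin 2) ℂ) * star ((AveragingRT.axialAvg U₀ c : SU 2) : Matrix (Fin 2) (Fin 2) ℂ) = 1 := by
    rw [hW0]; exact coe_mul_star_coe_SU _
  have hnear : ∀ᶠ t in 𝓝 (0 : ℝ), ‖((W t : SU 2) : Matrix (Fin 2) (Fin 2) ℂ) * star ((AveragingRT.axialAvg U₀ c : SU 2) : Matrix (Fin 2) (Fin 2) ℂ) - 1‖ <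
      innerRadius (specialUnitaryLogChart (Fin 2)) := by
    have hc0 : ContinuousAt (fun t : ℝ => ‖((W t : SU 2) : Matrix (Fin 2) (Fin 2) ℂ) * star ((AveragingRT.axialAvg U₀ c : SU 2) : Matrix (Fin 2) (Fin 2) ℂ) - 1‖) 0 :=
      continuous_norm.continuousAt.comp (((hcontW.mul continuous_const).sub continuous_const).continuousAt)
    refine hc0.eventually (isOpen_Iio.mem_nhds ?_)
    show ‖((W 0 : SU 2) : Matrix (Fin 2) (Fin 2) ℂ) * star ((AveragingRT.axialAvg U₀ c : SU 2) : Matrix (Fin 2) (Fin 2) ℂ) - 1‖ < _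
    rw [hone, sub_self, norm_zero]; exact innerRadius_pos
  filter_upwards [hnear] with t hn
  have hcoe : ((((if c ∈ s then E (fibreFamily U₀ c (W t)) else 1) * W t * ((if c ∈ s then E (loopHol U₀ c) else 1) * AveragingRT.axialAvg U₀ c)⁻¹ : SU 2)) :
      Matrix (Fin 2) (Fin 2) ℂ) = ((W t : SU 2) : Matrix (Fin 2) (Fin 2) ℂ) * star ((AveragingRT.axialAvg U₀ c : SU 2) : Matrix (Fin 2) (Fin 2) ℂ) := by
    rw [if_neg hc, if_neg hc, one_mul, one_mul, Submonoid.coe_mul, coe_inv_SU]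
  have hρ : ‖fundamentalRep (Fin 2) ((if c ∈ s then E (fibreFamily U₀ c (W t)) else 1) * W t *
      ((if c ∈ s then E (loopHol U₀ c) else 1) * AveragingRT.axialAvg U₀ c)⁻¹) - 1‖ < innerRadius (specialUnitaryLogChart (Fin 2)) := by
    rw [fundamentalRep_apply, hcoe]; exact hn
  rw [chartRead_ray_apply_self E s U₀ hj c X t]
  show ((hR.logChart ((if c ∈ s then E (fibreFamily U₀ c (W t)) else 1) * W t * ((if c ∈ s then E (loopHol U₀ c) else 1) * AveragingRT.axialAvg U₀ c)⁻¹) :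
      (specialUnitaryLogChart (Fin 2)).lie) : Matrix (Fin 2) (Fin 2) ℂ) = _
  rw [hR.coe_logChart hρ, fundamentalRep_apply, hcoe, hcoeW t]

/-- ★★★ **THE DIAGONAL BLOCKS ARE INJECTIVE.**  At `U₀` with `s`-families in the `1∕2`-guard, if `(Dψ(0)[X δ_{β(c)}])(c) = 0` then `X = 0`.  For `c ∈ s`: the matrix of the
`c`-component along the ray is eventually the `Kmat` model, whose velocity at `0` is `emlD(W₀)[(pre X pre⋆)·W₀]·K(W₀)⋆` (lit ✓`hasStrictFDerivAt_Kmat`, `D log(1) = id`), and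
`emlD(W₀)` kills no non-zero tangent vector (lit ✓`emlD_tangent_injective`: weights `|I|⁻¹ ≥ 0` of total `< 1`, guard `< 1∕2` — NO other smallness); for `c ∉ s` the velocity is
`pre·X·pre⋆`. [cite: Balaban1987RG1, (0.4) p.253] -/
theorem eq_zero_of_fderiv_chartRead_single_apply_self (hj : j + 1 ≤ P.m + P.K)
    (hEeml : ∀ W, (∀ i, ‖((W i : SU 2) : Matrix (Fin 2) (Fin 2) ℂ) - 1‖ < 1 / 2) →
      ((E W : SU 2) : Matrix (Fin 2) (Fin 2) ℂ) = eml fun i => ((W i : SU 2) : Matrix (Fin 2) (Fin 2) ℂ))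
    (hwin : ∀ c ∈ s, ∀ i, ‖((loopHol U₀ c i : SU 2) : Matrix (Fin 2) (Fin 2) ℂ) - 1‖ < 1 / 2)
    (c : PBond P (j + 1)) (X : (specialUnitaryLogChart (Fin 2)).lie)
    (hzero : fderiv ℝ (fun (A : PBond P j → (specialUnitaryLogChart (Fin 2)).lie) (c : PBond P (j + 1)) =>
      (isChartRep_specialUnitaryGroup (n := Fin 2)).logChart
        ((if c ∈ s then E (loopHol (fun b => (isChartRep_specialUnitaryGroup (n := Fin 2)).expChart (A b) * U₀ b) c) else 1) *
            AveragingRT.axialAvg (fun b => (isChartRep_specialUnitaryGroup (n := Fin 2)).expChart (A b) * U₀ b) c *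
          ((if c ∈ s then E (loopHol U₀ c) else 1) * AveragingRT.axialAvg U₀ c)⁻¹)) 0
      (Pi.single (centralBond c) X) c = 0) :
    X = 0 := by
  -- the coerced ray derivative is `0`
  have hdiff := (contDiffAt_chartRead_cellMap (P := P) (j := j) E s U₀ hEeml hwin).differentiableAt (by simp)
  have hray := hasDerivAt_coe_ray (P := P) (j := j) hdiff (Pi.single (centralBond c) X) c
  rw [hzero, ZeroMemClass.coe_zero] at hray
  -- unitary bookkeeping
  set uP : Matrix (Fin 2) (Fin 2) ℂ := ((pre U₀ c : SU 2) : Matrix (Fin 2) (Fin 2) ℂ) with huP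
  set g₀ : Matrix (Fin 2) (Fin 2) ℂ := ((U₀ (centralBond c) : SU 2) : Matrix (Fin 2) (Fin 2) ℂ) with hg₀
  set uQ : Matrix (Fin 2) (Fin 2) ℂ := ((post U₀ c : SU 2) : Matrix (Fin 2) (Fin 2) ℂ) with huQ
  set Xm : Matrix (Fin 2) (Fin 2) ℂ := ((X : (specialUnitaryLogChart (Fin 2)).lie) : Matrix (Fin 2) (Fin 2) ℂ) with hXm
  have huPuP : uP * star uP = 1 := coe_mul_star_coe_SU _
  have huPuP' : star uP * uP = 1 := star_coe_mul_coe_SU _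
  have hW₀eq : uP * g₀ * uQ = ((AveragingRT.axialAvg U₀ c : SU 2) : Matrix (Fin 2) (Fin 2) ℂ) := by
    rw [huP, hg₀, huQ, ← Submonoid.coe_mul, ← Submonoid.coe_mul, (fibre_basePoint (P := P) (j := j) U₀ c).1]
  have hvel : uP * (Xm * g₀) * uQ = (uP * Xm * star uP) * (uP * g₀ * uQ) := by
    rw [show (uP * Xm * star uP) * (uP * g₀ * uQ) = uP * Xm * (star uP * uP) * g₀ * uQ by noncomm_ring, huPuP']; noncomm_ring
  have hXskew : star Xm = -Xm := (mem_specialUnitaryLogChart_lie.1 X.2).1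
  have hconclude : Xm = 0 → X = 0 := fun h0 => Subtype.ext h0
  by_cases hc : c ∈ s
  · -- `c ∈ s`: Kmat model
    set hh : Fin (offCard c) → Matrix (Fin 2) (Fin 2) ℂ := fun k => ((offHol U₀ c k : SU 2) : Matrix (Fin 2) (Fin 2) ℂ) with hhh
    set w : Fin (offCard c) → ℝ := fun _ => emlWeight P with hw
    have heq := coe_chartRead_ray_self_eventuallyEq_of_mem E s U₀ hj hEeml hwin hc X
    have hfb := (fibre_basePoint (P := P) (j := j) U₀ c).2
    have hguard0 : ∀ i, ‖((fibreFamily U₀ c (AveragingRT.axialAvg U₀ c) i : SU 2) : Matrix (Fin 2) (Fin 2) ℂ) - 1‖ < 1 / 2 := by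
      intro i; rw [hfb]; exact hwin c hc i
    have hgK : ∀ k, ‖hh k * star (uP * g₀ * uQ) - 1‖ < 1 / 2 := by
      intro k
      have := hguard0 ((BlockAveragingEMLHaarAC.offEquiv c).symm k).1
      rwa [coe_fibreFamily_of_not_isCentral U₀ c _ _ ((BlockAveragingEMLHaarAC.offEquiv c).symm k).2, ← hW₀eq] at this
    set sK : Matrix (Fin 2) (Fin 2) ℂ := star (Kmat hh w ((AveragingRT.axialAvg U₀ c : SU 2) : Matrix (Fin 2) (Fin 2) ℂ)) with hsK
    have hK0 : Kmat hh w ((AveragingRT.axialAvg U₀ c : SU 2) : Matrix (Fin 2) (Fin 2) ℂ) =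
        ((((if c ∈ s then E (loopHol U₀ c) else 1) * AveragingRT.axialAvg U₀ c : SU 2)) : Matrix (Fin 2) (Fin 2) ℂ) := by
      rw [if_pos hc, Submonoid.coe_mul, ← hfb, coe_E_fibreFamily_eq_exp_sum E hEeml U₀ c hguard0, Kmat]
    have hone : Kmat hh w (uP * g₀ * uQ) * sK = 1 := by rw [hW₀eq, hsK, hK0]; exact coe_mul_star_coe_SU _
    have hone' : sK * Kmat hh w (uP * g₀ * uQ) = 1 := by rw [hW₀eq, hsK, hK0]; exact star_coe_mul_coe_SU _
    have hmodel := hasDerivAt_mlog_kmat_ray hh w uP g₀ uQ Xm sK (fun k => (hgK k).trans (by norm_num)) hone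
    have hmodel' : HasDerivAt (fun t : ℝ => mlog (Kmat hh w (uP * (NormedSpace.exp (t • Xm) * g₀) * uQ) * sK)) 0 0 :=
      hray.congr_of_eventuallyEq heq.symm
    have hD : emlD hh w (uP * g₀ * uQ) (uP * (Xm * g₀) * uQ) * sK = 0 := hmodel.unique hmodel'
    rw [hvel] at hD
    have hhu : ∀ k, hh k ∈ Matrix.unitaryGroup (Fin 2) ℂ := fun k => (Matrix.mem_specialUnitaryGroup_iff.1 (offHol U₀ c k).2).1
    have hW₀mem : uP * g₀ * uQ ∈ Matrix.unitaryGroup (Fin 2) ℂ := by rw [hW₀eq]; exact (Matrix.mem_specialUnitaryGroup_iff.1 (AveragingRT.axialAvg U₀ c).2).1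
    have hW₀u : (uP * g₀ * uQ) * star (uP * g₀ * uQ) = 1 := by rw [hW₀eq]; exact coe_mul_star_coe_SU _
    exact hconclude (eq_zero_of_emlD_conj_mul_eq_zero hhu (fun _ => emlWeight_nonneg P) (sum_emlWeight_lt_one c) hW₀mem hW₀u huPuP' hgK hXskew hone' hD)
  · -- `c ∉ s`: axial model
    have heq := coe_chartRead_ray_self_eventuallyEq_of_not_mem E s U₀ hj hc X
    have hone : (uP * g₀ * uQ) * star (uP * g₀ * uQ) = 1 := by rw [hW₀eq]; exact coe_mul_star_coe_SU _
    have hmodel := hasDerivAt_mlog_axial_ray uP g₀ uQ Xm hone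
    have hpt : (fun t : ℝ => mlog (uP * (NormedSpace.exp (t • Xm) * g₀) * uQ * star (uP * g₀ * uQ))) =ᶠ[𝓝 (0 : ℝ)]
        fun t : ℝ => mlog (uP * (NormedSpace.exp (t • Xm) * g₀) * uQ * star ((AveragingRT.axialAvg U₀ c : SU 2) : Matrix (Fin 2) (Fin 2) ℂ)) :=
      Eventually.of_forall fun t => by rw [hW₀eq]
    have hmodel' : HasDerivAt (fun t : ℝ => mlog (uP * (NormedSpace.exp (t • Xm) * g₀) * uQ * star (uP * g₀ * uQ))) 0 0 :=
      hray.congr_of_eventuallyEq (hpt.trans heq.symm)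
    have hD : uP * (Xm * g₀) * uQ * star (uP * g₀ * uQ) = 0 := hmodel.unique hmodel'
    rw [hvel, mul_assoc (uP * Xm * star uP) (uP * g₀ * uQ) (star (uP * g₀ * uQ)), hone, mul_one] at hD
    apply hconclude
    calc Xm = star uP * (uP * Xm * star uP) * uP := by
          rw [show star uP * (uP * Xm * star uP) * uP = (star uP * uP) * Xm * (star uP * uP) by noncomm_ring, huPuP', one_mul, mul_one]
      _ = 0 := by rw [hD, mul_zero, zero_mul]

end Blocks

end Summit.QuantumFields.YangMills.Theorems.FluctuationComparisonRegPrIntLS1aCellMapChartRead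

end
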